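import Mathlib
import Literature.RepresentationTheory.FiniteGroups.InducedClassFunction
import Literature.RepresentationTheory.FiniteGroups.BrauerInduction
import Summits.MatrixMultiplication.MatrixMultiplication.Theorems.SubgroupIdentityDesigns.Negative.ParabolicSubgroup
import Summits.MatrixMultiplication.MatrixMultiplication.Theorems.SubgroupIdentityDesigns.Negative.ParabolicRestriction

/-!
# The Mackey double sum for two maximal parabolics of `GL_N(F)`

Support file toward the maximal-parabolic **Mackey formula** `SteinbergTower.MackeyFormula`
(crux `SubgroupIdentityDesigns`, negative side; VALUE = reusable finite-group bookkeeping,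
NOT summit progress).

For `c, j ≤ N`, class data `σ` on `GL_c(F)`, `τ` on `GL_j(F)` and the Harish-Chandra induced
functions `I_c σ = hcInd hc σ`, `I_j τ = hcInd hj τ` (`ParabolicRestriction`), we prove the
**double-sum formula**

  `⟨I_c σ, I_j τ⟩_{GL_N} = (|P_c| |P_j|)⁻¹ ∑_{s ∈ GL_N} Φ(s)`,
  `Φ(s) = ∑_{y ∈ P_c} σ(ul_c y) · τ̃(s⁻¹ y⁻¹ s)`                     (`classInner_hcInd_hcInd`)

(`τ̃` = extension by zero of `τ ∘ ul_j` from `P_j`; `dcSum`), the **double-coset invariance**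
`Φ(p s q) = Φ(s)` for `p ∈ P_c`, `q ∈ P_j` (`dcSum_parab_mul`, `dcSum_mul_parab`), the
expression of `Φ(W)` as a sum over the **intersection group** `H_W = P_c ∩ W P_j W⁻¹`
(`meet`, `meetHom`, `dcSum_eq_sum_meet`), and the **fibre count** of `(p, q) ↦ p W q`:
`∑_{p ∈ P_c} ∑_{q ∈ P_j} f(p W q) = |H_W| · ∑_{s ∈ P_c W P_j} f(s)` (`sum_pair_eq`).
These are Serre, *Linear Representations of Finite Groups*, §7.3–7.4 (Mackey), specialised
to the pair `(P_c, P_j)`. [cite: SerreLinearRepresentations1977, §7.3]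
-/

set_option linter.dupNamespace false
set_option maxHeartbeats 800000

noncomputable section

open scoped BigOperators Classical
open Literature.RepresentationTheory.FiniteGroups

namespace Summit.MatrixMultiplication.MatrixMultiplication.Theorems.SubgroupIdentityDesigns.Negative

namespace ParabolicMackeySum

open ParabolicSubgroup ParabolicRestriction

variable {F : Type} [Field F] [Fintype F] [DecidableEq F] {N c j : ℕ}

/-! ## The summand `Φ(s)` -/

/-- `τ̃`: the extension by zero of `τ ∘ ul_j` from the parabolic `P_j` to `GL_N(F)`. -/
def extUl (hj : j ≤ N) (τ : GL (Fin j) F → ℂ) : GL (Fin N) F → ℂ :=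
  Function.extend (Subtype.val : parab F N j → GL (Fin N) F) (fun g => τ (ul hj g)) 0

/-- `τ̃(z) = τ(ul_j z)` on `P_j`. -/
theorem extUl_of_mem (hj : j ≤ N) (τ : GL (Fin j) F → ℂ) {z : GL (Fin N) F}
    (hz : z ∈ parab F N j) : extUl hj τ z = τ (ul hj ⟨z, hz⟩) :=
  extend_subtypeVal_apply (parab F N j) (fun g => τ (ul hj g)) ⟨z, hz⟩

/-- `τ̃(z) = 0` off `P_j`. -/
theorem extUl_of_not_mem (hj : j ≤ N) (τ : GL (Fin j) F → ℂ) {z : GL (Fin N) F}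
    (hz : z ∉ parab F N j) : extUl hj τ z = 0 :=
  extend_subtypeVal_of_not_mem (parab F N j) (fun g => τ (ul hj g)) hz

/-- `τ̃` is invariant under conjugation by `P_j` when `τ` is a class function. -/
theorem extUl_conj (hj : j ≤ N) {τ : GL (Fin j) F → ℂ} (hτ : IsClassFun τ) (q : parab F N j)
    (z : GL (Fin N) F) : extUl hj τ ((q : GL (Fin N) F)⁻¹ * z * q) = extUl hj τ z := by
  by_cases hz : z ∈ parab F N j
  · have hz' : (q : GL (Fin N) F)⁻¹ * z * q ∈ parab F N j :=
      (parab F N j).mul_mem ((parab F N j).mul_mem ((parab F N j).inv_mem q.2) hz) q.2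
    rw [extUl_of_mem hj τ hz', extUl_of_mem hj τ hz]
    have hq : (⟨(q : GL (Fin N) F)⁻¹ * z * q, hz'⟩ : parab F N j) = q⁻¹ * ⟨z, hz⟩ * q :=
      Subtype.ext (by simp only [Subgroup.coe_mul, Subgroup.coe_inv])
    rw [hq, map_mul, map_mul, map_inv]
    have h := hτ (ul hj ⟨z, hz⟩) (ul hj q)⁻¹
    rw [inv_inv] at h
    exact h
  · have hz' : (q : GL (Fin N) F)⁻¹ * z * q ∉ parab F N j := by
      intro h
      apply hz
      have h2 := (parab F N j).mul_mem ((parab F N j).mul_mem q.2 h) ((parab F N j).inv_mem q.2)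
      simpa [mul_assoc] using h2
    rw [extUl_of_not_mem hj τ hz', extUl_of_not_mem hj τ hz]

/-- **The Mackey summand** `Φ(s) = ∑_{y ∈ P_c} σ(ul_c y) τ̃(s⁻¹ y⁻¹ s)`. -/
def dcSum (hc : c ≤ N) (hj : j ≤ N) (σ : GL (Fin c) F → ℂ) (τ : GL (Fin j) F → ℂ)
    (s : GL (Fin N) F) : ℂ :=
  ∑ y : parab F N c, σ (ul hc y) * extUl hj τ (s⁻¹ * ((y : GL (Fin N) F))⁻¹ * s)

/-! ## The double-sum formula -/

/-- **Mackey double sum**: `⟨I_c σ, I_j τ⟩ = (|P_c| |P_j|)⁻¹ ∑_{s ∈ GL_N} Φ(s)` (Frobenius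
reciprocity for `P_c`, then the Frobenius formula for `I_j τ`). -/
theorem classInner_hcInd_hcInd (hc : c ≤ N) (hj : j ≤ N) (σ : GL (Fin c) F → ℂ)
    (τ : GL (Fin j) F → ℂ) :
    classInner (hcInd hc σ) (hcInd hj τ) =
      ((Nat.card (parab F N c) : ℂ)⁻¹ * (Nat.card (parab F N j) : ℂ)⁻¹) *
        ∑ s : GL (Fin N) F, dcSum hc hj σ τ s := by
  unfold hcInd
  rw [classInner_indClassFun_left (parab F N c) _ (isClassFun_indClassFun _ _), classInner_apply,
    ← Nat.card_eq_fintype_card]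
  have hterm : ∀ y : parab F N c,
      (fun g : parab F N c => σ (ul hc g)) y *
        (fun x : parab F N c => indClassFun (parab F N j) (fun g => τ (ul hj g)) (x : GL (Fin N) F)) y⁻¹ =
      (Nat.card (parab F N j) : ℂ)⁻¹ *
        ∑ s : GL (Fin N) F, σ (ul hc y) * extUl hj τ (s⁻¹ * ((y : GL (Fin N) F))⁻¹ * s) := by
    intro y
    simp only [indClassFun_apply, Subgroup.coe_inv, Finset.mul_sum]
    refine Finset.sum_congr rfl fun s _ => ?_
    simp only [extUl]
    ring
  rw [Finset.sum_congr rfl fun y _ => hterm y, ← Finset.mul_sum, Finset.sum_comm, mul_assoc]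
  rfl

/-! ## Double-coset invariance -/

/-- `Φ(p s) = Φ(s)` for `p ∈ P_c` (reindex `y ↦ p y p⁻¹`; `σ` a class function). -/
theorem dcSum_parab_mul (hc : c ≤ N) (hj : j ≤ N) {σ : GL (Fin c) F → ℂ} (hσ : IsClassFun σ)
    (τ : GL (Fin j) F → ℂ) (p : parab F N c) (s : GL (Fin N) F) :
    dcSum hc hj σ τ ((p : GL (Fin N) F) * s) = dcSum hc hj σ τ s := by
  unfold dcSum
  symm
  refine Fintype.sum_equiv (MulAut.conj p).toEquiv _ _ fun y => ?_
  have hy : ((MulAut.conj p).toEquiv y : parab F N c) = p * y * p⁻¹ := rfl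
  rw [hy, map_mul, map_mul, map_inv, hσ (ul hc y) (ul hc p)]
  congr 1
  simp only [Subgroup.coe_mul, Subgroup.coe_inv, mul_inv_rev, inv_inv]
  congr 1
  group

/-- `Φ(s q) = Φ(s)` for `q ∈ P_j` (`τ̃` is `P_j`-conjugation invariant). -/
theorem dcSum_mul_parab (hc : c ≤ N) (hj : j ≤ N) (σ : GL (Fin c) F → ℂ) {τ : GL (Fin j) F → ℂ}
    (hτ : IsClassFun τ) (s : GL (Fin N) F) (q : parab F N j) :
    dcSum hc hj σ τ (s * q) = dcSum hc hj σ τ s := by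
  unfold dcSum
  refine Finset.sum_congr rfl fun y _ => ?_
  congr 1
  have h : (s * q)⁻¹ * ((y : GL (Fin N) F))⁻¹ * (s * q) =
      (q : GL (Fin N) F)⁻¹ * (s⁻¹ * ((y : GL (Fin N) F))⁻¹ * s) * q := by group
  rw [h, extUl_conj hj hτ]

/-- `Φ(p s q) = Φ(s)`: `Φ` is constant on `(P_c, P_j)`-double cosets. -/
theorem dcSum_parab_mul_parab (hc : c ≤ N) (hj : j ≤ N) {σ : GL (Fin c) F → ℂ}
    (hσ : IsClassFun σ) {τ : GL (Fin j) F → ℂ} (hτ : IsClassFun τ) (p : parab F N c)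
    (s : GL (Fin N) F) (q : parab F N j) :
    dcSum hc hj σ τ ((p : GL (Fin N) F) * s * q) = dcSum hc hj σ τ s := by
  rw [dcSum_mul_parab hc hj σ hτ, dcSum_parab_mul hc hj hσ]

/-! ## The intersection group `H_W = P_c ∩ W P_j W⁻¹` -/

/-- `H_W = {y ∈ P_c : W⁻¹ y W ∈ P_j} = P_c ∩ W P_j W⁻¹`. -/
def meet (c j : ℕ) (W : GL (Fin N) F) : Subgroup (GL (Fin N) F) where
  carrier := {y | y ∈ parab F N c ∧ W⁻¹ * y * W ∈ parab F N j}
  one_mem' := ⟨(parab F N c).one_mem, by simp⟩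
  mul_mem' := by
    rintro y z ⟨hy, hy'⟩ ⟨hz, hz'⟩
    refine ⟨(parab F N c).mul_mem hy hz, ?_⟩
    have h := (parab F N j).mul_mem hy' hz'
    have e : W⁻¹ * y * W * (W⁻¹ * z * W) = W⁻¹ * (y * z) * W := by group
    rwa [e] at h
  inv_mem' := by
    rintro y ⟨hy, hy'⟩
    refine ⟨(parab F N c).inv_mem hy, ?_⟩
    have h := (parab F N j).inv_mem hy'
    have e : (W⁻¹ * y * W)⁻¹ = W⁻¹ * y⁻¹ * W := by group
    rwa [e] at h

/-- Membership in `H_W`. -/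
theorem mem_meet {W y : GL (Fin N) F} :
    y ∈ meet c j W ↔ y ∈ parab F N c ∧ W⁻¹ * y * W ∈ parab F N j := Iff.rfl

/-- The homomorphism `Ψ_W : H_W → GL_c × GL_j`, `y ↦ (ul_c y, ul_j (W⁻¹ y W))`. -/
def meetHom (hc : c ≤ N) (hj : j ≤ N) (W : GL (Fin N) F) :
    meet c j W →* GL (Fin c) F × GL (Fin j) F where
  toFun y := (ul hc ⟨(y : GL (Fin N) F), y.2.1⟩, ul hj ⟨W⁻¹ * (y : GL (Fin N) F) * W, y.2.2⟩)
  map_one' := by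
    refine Prod.ext ?_ ?_
    · show ul hc ⟨((1 : meet c j W) : GL (Fin N) F), _⟩ = 1
      have h : (⟨((1 : meet c j W) : GL (Fin N) F), (1 : meet c j W).2.1⟩ : parab F N c) = 1 :=
        Subtype.ext rfl
      rw [h, map_one]
    · show ul hj ⟨W⁻¹ * ((1 : meet c j W) : GL (Fin N) F) * W, _⟩ = 1
      have h : (⟨W⁻¹ * ((1 : meet c j W) : GL (Fin N) F) * W, (1 : meet c j W).2.2⟩ :
          parab F N j) = 1 :=
        Subtype.ext (by simp)
      rw [h, map_one]
  map_mul' y z := by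
    refine Prod.ext ?_ ?_
    · show ul hc ⟨((y * z : meet c j W) : GL (Fin N) F), _⟩ =
        ul hc ⟨(y : GL (Fin N) F), _⟩ * ul hc ⟨(z : GL (Fin N) F), _⟩
      rw [← map_mul]
      rfl
    · show ul hj ⟨W⁻¹ * ((y * z : meet c j W) : GL (Fin N) F) * W, _⟩ =
        ul hj ⟨W⁻¹ * (y : GL (Fin N) F) * W, _⟩ * ul hj ⟨W⁻¹ * (z : GL (Fin N) F) * W, _⟩
      rw [← map_mul]
      congr 1
      refine Subtype.ext ?_
      show W⁻¹ * ((y : GL (Fin N) F) * z) * W = W⁻¹ * (y : GL (Fin N) F) * W * (W⁻¹ * (z : GL (Fin N) F) * W)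
      group

/-- First component of `Ψ_W`. -/
theorem meetHom_fst (hc : c ≤ N) (hj : j ≤ N) (W : GL (Fin N) F) (y : meet c j W) :
    (meetHom hc hj W y).1 = ul hc ⟨y, y.2.1⟩ := rfl

/-- Second component of `Ψ_W`. -/
theorem meetHom_snd (hc : c ≤ N) (hj : j ≤ N) (W : GL (Fin N) F) (y : meet c j W) :
    (meetHom hc hj W y).2 = ul hj ⟨W⁻¹ * (y : GL (Fin N) F) * W, y.2.2⟩ := rfl

/-- **`Φ(W)` as a sum over `H_W`**: `Φ(W) = ∑_{y ∈ H_W} σ(Ψ_W(y).1) τ(Ψ_W(y).2⁻¹)` (the terms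
with `W⁻¹ y W ∉ P_j` vanish). -/
theorem dcSum_eq_sum_meet (hc : c ≤ N) (hj : j ≤ N) (σ : GL (Fin c) F → ℂ)
    (τ : GL (Fin j) F → ℂ) (W : GL (Fin N) F) :
    dcSum hc hj σ τ W =
      ∑ y : meet c j W, σ (meetHom hc hj W y).1 * τ ((meetHom hc hj W y).2)⁻¹ := by
  -- the common form: a sum over `GL_N` of a function supported on `H_W`
  set K : GL (Fin N) F → ℂ := fun y =>
    if h : y ∈ meet c j W then σ (ul hc ⟨y, h.1⟩) * τ (ul hj ⟨W⁻¹ * y * W, h.2⟩)⁻¹ else 0 with hK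
  have h1 : dcSum hc hj σ τ W = ∑ y : parab F N c, K y := by
    unfold dcSum
    refine Finset.sum_congr rfl fun y _ => ?_
    by_cases hy : W⁻¹ * (y : GL (Fin N) F) * W ∈ parab F N j
    · have hmem : (y : GL (Fin N) F) ∈ meet c j W := ⟨y.2, hy⟩
      have hy' : W⁻¹ * ((y : GL (Fin N) F))⁻¹ * W ∈ parab F N j := by
        have h := (parab F N j).inv_mem hy
        have e : (W⁻¹ * (y : GL (Fin N) F) * W)⁻¹ = W⁻¹ * ((y : GL (Fin N) F))⁻¹ * W := by group
        rwa [e] at h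
      rw [hK]
      simp only [dif_pos hmem]
      rw [extUl_of_mem hj τ hy']
      have e : (⟨W⁻¹ * ((y : GL (Fin N) F))⁻¹ * W, hy'⟩ : parab F N j) =
          (⟨W⁻¹ * (y : GL (Fin N) F) * W, hy⟩ : parab F N j)⁻¹ :=
        Subtype.ext (by
          show W⁻¹ * ((y : GL (Fin N) F))⁻¹ * W = (W⁻¹ * (y : GL (Fin N) F) * W)⁻¹
          group)
      rw [e, map_inv]
    · have hmem : (y : GL (Fin N) F) ∉ meet c j W := fun h => hy h.2
      have hy' : W⁻¹ * ((y : GL (Fin N) F))⁻¹ * W ∉ parab F N j := by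
        intro h
        apply hy
        have h2 := (parab F N j).inv_mem h
        have e : (W⁻¹ * ((y : GL (Fin N) F))⁻¹ * W)⁻¹ = W⁻¹ * (y : GL (Fin N) F) * W := by group
        rwa [e] at h2
      rw [hK]
      simp only [dif_neg hmem]
      rw [extUl_of_not_mem hj τ hy', mul_zero]
  have h2 : ∑ y : parab F N c, K y = ∑ y : GL (Fin N) F, K y := by
    rw [← Finset.sum_subtype (Finset.univ.filter (· ∈ parab F N c)) (by simp) K]
    rw [Finset.sum_filter]
    refine Finset.sum_congr rfl fun y _ => ?_
    by_cases hy : y ∈ parab F N c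
    · rw [if_pos hy]
    · rw [if_neg hy, hK]
      simp only
      rw [dif_neg (fun h => hy h.1)]
  have h3 : ∑ y : GL (Fin N) F, K y = ∑ y : meet c j W, K y := by
    rw [← Finset.sum_subtype (Finset.univ.filter (· ∈ meet c j W)) (by simp) K]
    rw [Finset.sum_filter]
    refine Finset.sum_congr rfl fun y _ => ?_
    by_cases hy : y ∈ meet c j W
    · rw [if_pos hy]
    · rw [if_neg hy, hK]
      simp only
      rw [dif_neg hy]
  rw [h1, h2, h3]
  refine Finset.sum_congr rfl fun y _ => ?_
  rw [hK]
  simp only [dif_pos y.2]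
  rfl

/-! ## The fibre count of `(p, q) ↦ p W q` -/

/-- The double coset `P_c W P_j` as a finset. -/
def dcoset (c j : ℕ) (W : GL (Fin N) F) : Finset (GL (Fin N) F) :=
  Finset.univ.filter fun s => ∃ p ∈ parab F N c, ∃ q ∈ parab F N j, s = p * W * q

/-- Membership in the double coset. -/
theorem mem_dcoset {W s : GL (Fin N) F} :
    s ∈ dcoset c j W ↔ ∃ p ∈ parab F N c, ∃ q ∈ parab F N j, s = p * W * q := by
  simp [dcoset]

/-- The fibre of `(p, q) ↦ p W q` over a point `p₀ W q₀` of the double coset is in bijection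
with `H_W` (`h ↦ (p₀ h, W⁻¹ h⁻¹ W q₀)`). -/
def fibreEquiv (W : GL (Fin N) F) {p₀ q₀ : GL (Fin N) F} (hp₀ : p₀ ∈ parab F N c)
    (hq₀ : q₀ ∈ parab F N j) :
    {x : parab F N c × parab F N j // (x.1 : GL (Fin N) F) * W * x.2 = p₀ * W * q₀} ≃
      meet c j W where
  toFun x := ⟨p₀⁻¹ * x.1.1, by
    refine ⟨(parab F N c).mul_mem ((parab F N c).inv_mem hp₀) x.1.1.2, ?_⟩
    have hx := x.2
    have e : W⁻¹ * (p₀⁻¹ * (x.1.1 : GL (Fin N) F)) * W = q₀ * ((x.1.2 : GL (Fin N) F))⁻¹ := by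
      have : (p₀⁻¹ * (x.1.1 : GL (Fin N) F)) * W = W * (q₀ * ((x.1.2 : GL (Fin N) F))⁻¹) := by
        calc (p₀⁻¹ * (x.1.1 : GL (Fin N) F)) * W
            = p₀⁻¹ * ((x.1.1 : GL (Fin N) F) * W * x.1.2) * ((x.1.2 : GL (Fin N) F))⁻¹ := by group
          _ = p₀⁻¹ * (p₀ * W * q₀) * ((x.1.2 : GL (Fin N) F))⁻¹ := by rw [hx]
          _ = W * (q₀ * ((x.1.2 : GL (Fin N) F))⁻¹) := by group
      rw [mul_assoc W⁻¹, this]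
      group
    rw [e]
    exact (parab F N j).mul_mem hq₀ ((parab F N j).inv_mem x.1.2.2)⟩
  invFun h := ⟨(⟨p₀ * h, (parab F N c).mul_mem hp₀ h.2.1⟩,
      ⟨W⁻¹ * ((h : GL (Fin N) F))⁻¹ * W * q₀, by
        have h1 : W⁻¹ * ((h : GL (Fin N) F))⁻¹ * W ∈ parab F N j := (h⁻¹).2.2
        exact (parab F N j).mul_mem h1 hq₀⟩), by
    show p₀ * (h : GL (Fin N) F) * W * (W⁻¹ * ((h : GL (Fin N) F))⁻¹ * W * q₀) = p₀ * W * q₀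
    group⟩
  left_inv x := by
    obtain ⟨⟨p, q⟩, hx⟩ := x
    refine Subtype.ext (Prod.ext (Subtype.ext ?_) (Subtype.ext ?_))
    · show p₀ * (p₀⁻¹ * (p : GL (Fin N) F)) = p
      group
    · show W⁻¹ * (p₀⁻¹ * (p : GL (Fin N) F))⁻¹ * W * q₀ = q
      have hx' : (p : GL (Fin N) F) * W * q = p₀ * W * q₀ := hx
      calc W⁻¹ * (p₀⁻¹ * (p : GL (Fin N) F))⁻¹ * W * q₀
          = W⁻¹ * (p : GL (Fin N) F)⁻¹ * (p₀ * W * q₀) := by group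
        _ = W⁻¹ * (p : GL (Fin N) F)⁻¹ * ((p : GL (Fin N) F) * W * q) := by rw [hx']
        _ = q := by group
  right_inv h := by
    refine Subtype.ext ?_
    show p₀⁻¹ * (p₀ * (h : GL (Fin N) F)) = h
    group

/-- **Fibre count**: `∑_{p ∈ P_c} ∑_{q ∈ P_j} f(p W q) = |H_W| · ∑_{s ∈ P_c W P_j} f(s)`. -/
theorem sum_pair_eq (W : GL (Fin N) F) (f : GL (Fin N) F → ℂ) :
    ∑ p : parab F N c, ∑ q : parab F N j, f ((p : GL (Fin N) F) * W * q) =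
      (Nat.card (meet c j W) : ℂ) * ∑ s ∈ dcoset c j W, f s := by
  let m : parab F N c × parab F N j → GL (Fin N) F := fun x => (x.1 : GL (Fin N) F) * W * x.2
  have h1 : ∑ p : parab F N c, ∑ q : parab F N j, f ((p : GL (Fin N) F) * W * q) =
      ∑ x : parab F N c × parab F N j, f (m x) := (Fintype.sum_prod_type' _).symm
  rw [h1, Finset.sum_comp f m, Finset.mul_sum]
  have himg : (Finset.univ : Finset (parab F N c × parab F N j)).image m = dcoset c j W := by
    ext s
    simp only [Finset.mem_image, Finset.mem_univ, true_and, mem_dcoset]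
    constructor
    · rintro ⟨x, rfl⟩
      exact ⟨x.1, x.1.2, x.2, x.2.2, rfl⟩
    · rintro ⟨p, hp, q, hq, rfl⟩
      exact ⟨(⟨p, hp⟩, ⟨q, hq⟩), rfl⟩
  rw [himg]
  refine Finset.sum_congr rfl fun s hs => ?_
  obtain ⟨p₀, hp₀, q₀, hq₀, rfl⟩ := mem_dcoset.mp hs
  have hcard : (Finset.univ.filter fun x : parab F N c × parab F N j => m x = p₀ * W * q₀).card =
      Nat.card (meet c j W) := by
    rw [← Fintype.card_subtype, Nat.card_eq_fintype_card]
    exact Fintype.card_congr (fibreEquiv W hp₀ hq₀)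
  rw [hcard, nsmul_eq_mul]

/-- **Sum over a double coset**: for double-coset-invariant data,
`|H_W| · ∑_{s ∈ P_c W P_j} Φ(s) = |P_c| |P_j| Φ(W)`. -/
theorem card_meet_mul_sum_dcoset (hc : c ≤ N) (hj : j ≤ N) {σ : GL (Fin c) F → ℂ}
    (hσ : IsClassFun σ) {τ : GL (Fin j) F → ℂ} (hτ : IsClassFun τ) (W : GL (Fin N) F) :
    (Nat.card (meet c j W) : ℂ) * ∑ s ∈ dcoset c j W, dcSum hc hj σ τ s =
      (Nat.card (parab F N c) : ℂ) * Nat.card (parab F N j) * dcSum hc hj σ τ W := by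
  rw [← sum_pair_eq W (dcSum hc hj σ τ)]
  simp only [dcSum_parab_mul_parab hc hj hσ hτ, Finset.sum_const, Finset.card_univ, nsmul_eq_mul,
    ← Nat.card_eq_fintype_card]
  ring

end ParabolicMackeySum

end Summit.MatrixMultiplication.MatrixMultiplication.Theorems.SubgroupIdentityDesigns.Negative

end
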